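import Literature.Geometry.Lorentzian.GeodesicConfinement
import Literature.Geometry.Lorentzian.CurvatureSymmetries
import Literature.Geometry.Lorentzian.LeviCivitaProofs
import Literature.Geometry.Riemannian.IsotropicCurvature
import Mathlib.Geometry.Manifold.IsManifold.InteriorBoundary
import Mathlib.Geometry.Manifold.ContMDiffMFDeriv
import Mathlib.Analysis.SpecialFunctions.Log.Deriv
import HarnessLib

/-!
# Asymptotically hyperbolic (conformally compact) metrics are complete; sign of the sectional
# curvature on arbitrary pairs

Support file (everything proved, no definitions, no named facts) for the discharge of
`Literature.Geometry.Riemannian.ggsu_boundary_sphere_of_nonTrapping_of_nonpos`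
(`SimpleAHBoundarySphere.lean`; Graham–Guillarmou–Stefanov–Uhlmann, Ann. Inst. Fourier 69 (2019),
Prop. 5.13 and p. 3: "The metric `g` is a complete metric").

* `curvatureForm_nonpos_of_orthonormal` — if `Rm(X, Y, Y, X) ≤ 0` for all `g`-orthonormal pairs
  then `Rm(X, Y, Y, X) ≤ 0` for all pairs (Gram–Schmidt and the symmetries of `Rm`).
* `exists_sq_mfderiv_le_mul_val` — on a compact manifold (any model with corners) carrying a
  positive definite metric `ḡ`, a `C¹` function `ρ` has `|dρ(w)|² ≤ C ḡ(w, w)` uniformly.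
* `isGeodesicallyComplete_of_conformallyCompact` — **a conformally compact Riemannian metric is
  geodesically complete** (Mazzeo 1988, §1; GGSU 2019, p. 3): if `j : N → X` embeds `N` as the
  interior of a compact manifold with boundary `X`, `ρ ≥ 0` is `C¹` on `X` and vanishes exactly on
  `∂X`, and `j^* ḡ = (ρ ∘ j)² g` for a Riemannian metric `ḡ` on `X`, then `g` is geodesically
  complete. Proof: Gordon's criterion (`isGeodesicallyComplete_of_properFunction`) with the proper
  function `-log (ρ ∘ j)`, whose `g`-gradient is bounded because `|dρ|_ḡ` is bounded on the compact
  `X` and `|v|_g = |dj v|_ḡ / ρ`.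

## References

* C. R. Graham, C. Guillarmou, P. Stefanov, G. Uhlmann, *X-ray transform and boundary rigidity
  for asymptotically hyperbolic manifolds*, Ann. Inst. Fourier 69 (2019), p. 3. [GrahamEtAl2020]
* R. Mazzeo, *The Hodge cohomology of a conformally compact metric*, J. Diff. Geom. 28 (1988),
  §1 (completeness of conformally compact metrics).
* W. B. Gordon, Proc. Amer. Math. Soc. 37 (1973) 221–225. [Gordon1973]
-/

noncomputable section

open Bundle Set Filter Function
open scoped Manifold ContDiff Topology

namespace Literature.Geometry.Riemannian

namespace SimpleAH

open Literature.Geometry.Lorentzian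
open Literature.Geometry.Lorentzian.PseudoRiemannianMetric

variable {E : Type*} [NormedAddCommGroup E] [NormedSpace ℝ E] {H : Type*} [TopologicalSpace H]
  {I : ModelWithCorners ℝ E H} {M : Type*} [TopologicalSpace M] [ChartedSpace H M]
  [IsManifold I ∞ M] {n : ℕ∞ω}

/-! ### Sign of `Rm(X, Y, Y, X)` from orthonormal pairs -/

section CurvatureSign

variable {g : PseudoRiemannianMetric I n E (TangentSpace I : M → Type _)}

/-- Expansion of `Rm(a e₁, b e₁ + c e₂, b e₁ + c e₂, a e₁)` for a curvature form which is
antisymmetric in its first pair and alternating in its second pair. [folklore] -/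
theorem curvatureForm_expand (cov : CovariantDerivative I E (TangentSpace I : M → Type _))
    (hself : ∀ (x : M) (X Y Z : TangentSpace I x), g.curvatureForm cov x X Y Z Z = 0)
    (x : M) (e₁ e₂ : TangentSpace I x) (a b c : ℝ) :
    g.curvatureForm cov x (a • e₁) (b • e₁ + c • e₂) (b • e₁ + c • e₂) (a • e₁) =
      (a * c) ^ 2 * g.curvatureForm cov x e₁ e₂ e₂ e₁ := by
  -- skew-adjointness in the last pair, by polarization of `hself`
  have hskew : ∀ (X Y Z W : TangentSpace I x),
      g.curvatureForm cov x X Y Z W = -g.curvatureForm cov x X Y W Z := by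
    intro X Y Z W
    have h := hself x X Y (Z + W)
    have hZ := hself x X Y Z
    have hW := hself x X Y W
    simp only [PseudoRiemannianMetric.curvatureForm, map_add, FunLike.coe_add,
      Pi.add_apply] at h hZ hW ⊢
    linarith
  have h11 : ∀ Z W : TangentSpace I x, g.curvatureForm cov x e₁ e₁ Z W = 0 := by
    intro Z W
    have h := g.curvatureForm_antisymm cov x e₁ e₁ Z W
    linarith
  simp only [PseudoRiemannianMetric.curvatureForm, map_add, map_smul, FunLike.coe_add,
    Pi.add_apply, FunLike.coe_smul, Pi.smul_apply, smul_eq_mul] at hskew h11 ⊢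
  have e1 := h11 e₁ e₁
  have e2 := h11 e₂ e₁
  have e4 := hself x e₁ e₂ e₁
  simp only [PseudoRiemannianMetric.curvatureForm] at e4
  rw [e1, e2, e4]
  ring

/-- **Nonpositive sectional curvature on orthonormal pairs gives `Rm(X, Y, Y, X) ≤ 0` on all
pairs.** For a positive definite metric and a connection whose curvature form is antisymmetric in
the first pair and alternating in the second, `Rm(X,Y,Y,X) = (ac)² Rm(e₁,e₂,e₂,e₁)` after
Gram–Schmidt (`X = a e₁`, `Y = b e₁ + c e₂`). [folklore] -/
theorem curvatureForm_nonpos_of_orthonormal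
    (cov : CovariantDerivative I E (TangentSpace I : M → Type _))
    (hpos : ∀ (x : M) (v : TangentSpace I x), v ≠ 0 → 0 < g.val x v v)
    (hself : ∀ (x : M) (X Y Z : TangentSpace I x), g.curvatureForm cov x X Y Z Z = 0)
    (hsec : ∀ (x : M) (X Y : TangentSpace I x), g.val x X X = 1 → g.val x Y Y = 1 →
      g.val x X Y = 0 → g.curvatureForm cov x X Y Y X ≤ 0)
    (x : M) (X Y : TangentSpace I x) : g.curvatureForm cov x X Y Y X ≤ 0 := by
  by_cases hX : X = 0
  · subst hX
    simp [PseudoRiemannianMetric.curvatureForm]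
  -- normalise `X`
  set a : ℝ := Real.sqrt (g.val x X X) with ha_def
  have hXX : 0 < g.val x X X := hpos x X hX
  have ha : 0 < a := Real.sqrt_pos.2 hXX
  have ha2 : a ^ 2 = g.val x X X := Real.sq_sqrt hXX.le
  set e₁ : TangentSpace I x := a⁻¹ • X with he₁_def
  have hXe : X = a • e₁ := by
    rw [he₁_def, smul_smul, mul_inv_cancel₀ ha.ne', one_smul]
  have he₁ : g.val x e₁ e₁ = 1 := by
    simp only [he₁_def, map_smul, FunLike.coe_smul, Pi.smul_apply, smul_eq_mul, ← ha2]
    field_simp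
  -- the component of `Y` orthogonal to `e₁`
  set b : ℝ := g.val x Y e₁ with hb_def
  set Y' : TangentSpace I x := Y - b • e₁ with hY'_def
  have hY'e : g.val x Y' e₁ = 0 := by
    simp only [hY'_def, map_sub, map_smul, FunLike.coe_sub, Pi.sub_apply,
      FunLike.coe_smul, Pi.smul_apply, smul_eq_mul, he₁, hb_def, mul_one, sub_self]
  by_cases hY' : Y' = 0
  · -- `Y = b e₁`: the plane is degenerate and `Rm(X,Y,Y,X) = 0`
    have hYe : Y = b • e₁ + (0 : ℝ) • e₁ := by
      rw [zero_smul, add_zero]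
      exact (sub_eq_zero.1 hY')
    rw [hXe, hYe, curvatureForm_expand cov hself x e₁ e₁ a b 0]
    simp
  set c : ℝ := Real.sqrt (g.val x Y' Y') with hc_def
  have hYY : 0 < g.val x Y' Y' := hpos x Y' hY'
  have hc : 0 < c := Real.sqrt_pos.2 hYY
  have hc2 : c ^ 2 = g.val x Y' Y' := Real.sq_sqrt hYY.le
  set e₂ : TangentSpace I x := c⁻¹ • Y' with he₂_def
  have hY'e₂ : Y' = c • e₂ := by
    rw [he₂_def, smul_smul, mul_inv_cancel₀ hc.ne', one_smul]
  have he₂ : g.val x e₂ e₂ = 1 := by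
    simp only [he₂_def, map_smul, FunLike.coe_smul, Pi.smul_apply, smul_eq_mul, ← hc2]
    field_simp
  have he₁₂ : g.val x e₁ e₂ = 0 := by
    simp only [he₂_def, map_smul, smul_eq_mul]
    rw [g.symm x e₁ Y', hY'e, mul_zero]
  have hYe : Y = b • e₁ + c • e₂ := by
    rw [← hY'e₂, hY'_def]
    abel
  rw [hXe, hYe, curvatureForm_expand cov hself x e₁ e₂ a b c]
  exact mul_nonpos_of_nonneg_of_nonpos (sq_nonneg _) (hsec x e₁ e₂ he₁ he₂ he₁₂)

/-- The curvature form of the Levi-Civita connection of a `C^n` metric, `n ≥ 2`, is alternating in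
its second pair (`Rm(X, Y, Z, Z) = 0`; O'Neill 1983, Ch. 3, Prop. 3.36 (2)), from the proved facts
`isLeviCivita_leviCivita` and `isLocallyContMDiff_leviCivita` of the tree.
[cite: ONeill1983, Ch. 3, Prop. 3.36 (2)] -/
theorem curvatureForm_leviCivita_self [FiniteDimensional ℝ E] [CompleteSpace E] [Fact (1 ≤ n)]
    [g.HasLeviCivita] (hn : 2 ≤ n) (x : M) (X Y Z : TangentSpace I x) :
    g.curvatureForm g.leviCivita x X Y Z Z = 0 := by
  have hLC : g.IsLeviCivita g.leviCivita := isLeviCivita_leviCivita_holds (g := g)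
  have hk1 : ((1 : ℕ∞) : ℕ∞ω) + 1 ≤ n := by
    rw [show ((1 : ℕ∞) : ℕ∞ω) + 1 = 2 by norm_num]
    exact hn
  have hreg : g.leviCivita.IsLocallyContMDiff 1 := g.isLocallyContMDiff_leviCivita_holds 1 hk1
  exact val_curvature_self_eq_zero hLC.2 hreg hn x X Y Z

/-- **`K ≤ 0` on orthonormal pairs implies `Rm(X, Y, Y, X) ≤ 0` everywhere**, for the Levi-Civita
connection of a positive definite `C^n` metric, `n ≥ 2`. [folklore] -/
theorem curvatureForm_leviCivita_nonpos_of_orthonormal [FiniteDimensional ℝ E] [CompleteSpace E]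
    [Fact (1 ≤ n)] [g.HasLeviCivita] (hn : 2 ≤ n) (hg : g.IsRiemannian)
    (hsec : ∀ (x : M) (X Y : TangentSpace I x), g.val x X X = 1 → g.val x Y Y = 1 →
      g.val x X Y = 0 → g.curvatureForm g.leviCivita x X Y Y X ≤ 0)
    (x : M) (X Y : TangentSpace I x) : g.curvatureForm g.leviCivita x X Y Y X ≤ 0 :=
  curvatureForm_nonpos_of_orthonormal g.leviCivita hg (curvatureForm_leviCivita_self hn) hsec x X Y

end CurvatureSign

/-! ### A uniform bound `|dρ(w)|² ≤ C ḡ(w, w)` on a compact manifold -/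

section UniformBound

variable {g : PseudoRiemannianMetric I n E (TangentSpace I : M → Type _)}

/-- The differential of a `C¹` function as a continuous function on the tangent bundle,
`p ↦ dρ_{π p}(p)` (the fibre component of the tangent map of `ρ`). [folklore] -/
theorem continuous_mvfderiv_tangentBundle {ρ : M → ℝ} (hρ : ContMDiff I 𝓘(ℝ, ℝ) 1 ρ) :
    Continuous fun p : TangentBundle I M ↦ mvfderiv I ρ p.proj p.2 := by
  have h1 : Continuous (tangentMap I 𝓘(ℝ, ℝ) ρ) := hρ.continuous_tangentMap le_rfl
  have h2 : Continuous fun q : TangentBundle 𝓘(ℝ, ℝ) ℝ ↦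
      (tangentBundleModelSpaceHomeomorph 𝓘(ℝ, ℝ) q).2 :=
    continuous_snd.comp (tangentBundleModelSpaceHomeomorph 𝓘(ℝ, ℝ)).continuous
  have h3 := h2.comp h1
  have heq : (fun p : TangentBundle I M ↦ mvfderiv I ρ p.proj p.2) =
      (fun q : TangentBundle 𝓘(ℝ, ℝ) ℝ ↦ (tangentBundleModelSpaceHomeomorph 𝓘(ℝ, ℝ) q).2) ∘
        tangentMap I 𝓘(ℝ, ℝ) ρ := by
    funext p
    rfl
  rw [heq]
  exact h3

/-- **A uniform gradient bound on a compact manifold.** On a compact manifold (any model with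
corners) with a positive definite `C^n` metric `g`, every `C¹` function `ρ` satisfies
`(dρ_x w)² ≤ C g_x(w, w)` for one constant `C > 0` and all tangent vectors `w`: over a compact
neighbourhood inside a trivialising chart of `TM`, `g` is bounded below and `dρ` above on the chart
unit sphere, by continuity and compactness; finitely many such neighbourhoods cover `M`.
[folklore] -/
theorem exists_sq_mfderiv_le_mul_val [CompactSpace M] [T2Space M] [FiniteDimensional ℝ E]
    (hpos : ∀ (x : M) (v : TangentSpace I x), v ≠ 0 → 0 < g.val x v v)
    {ρ : M → ℝ} (hρ : ContMDiff I 𝓘(ℝ, ℝ) 1 ρ) :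
    ∃ C : ℝ, 0 < C ∧ ∀ (x : M) (w : TangentSpace I x),
      (mvfderiv I ρ x w) ^ 2 ≤ C * g.val x w w := by
  classical
  have hF := g.continuous_val_tangentBundle
  have hD := continuous_mvfderiv_tangentBundle (I := I) (M := M) hρ
  -- the local statement near each point
  have hloc : ∀ x : M, ∃ N ∈ 𝓝 x, ∃ C : ℝ, 0 < C ∧ ∀ p : TangentBundle I M, p.proj ∈ N →
      (mvfderiv I ρ p.proj p.2) ^ 2 ≤ C * g.val p.proj p.2 p.2 := by
    intro x
    set e := trivializationAt E (TangentSpace I : M → Type _) x with he_def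
    have hxe : x ∈ e.baseSet := FiberBundle.mem_baseSet_trivializationAt' x
    obtain ⟨N, hN, hNe, hNc⟩ := local_compact_nhds (e.open_baseSet.mem_nhds hxe)
    -- the two functions in the chart `e`
    set Φ : M × E → ℝ := fun yw ↦ g.val yw.1 (e.symm yw.1 yw.2) (e.symm yw.1 yw.2) with hΦ_def
    set Ψ : M × E → ℝ := fun yw ↦ mvfderiv I ρ yw.1 (e.symm yw.1 yw.2) with hΨ_def
    have hΦc : ContinuousOn Φ (e.baseSet ×ˢ univ) := hF.comp_continuousOn e.continuousOn_symm
    have hΨc : ContinuousOn Ψ (e.baseSet ×ˢ univ) := by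
      have h := hD.comp_continuousOn e.continuousOn_symm
      simpa only [hΨ_def, Function.comp_def] using h
    have hK : IsCompact (N ×ˢ Metric.sphere (0 : E) 1) := hNc.prod (isCompact_sphere 0 1)
    have hKsub : N ×ˢ Metric.sphere (0 : E) 1 ⊆ e.baseSet ×ˢ univ := prod_mono hNe (subset_univ _)
    -- a positive lower bound for `Φ` and an upper bound for `|Ψ|` on `N × sphere`
    obtain ⟨m, hm, hmΦ⟩ : ∃ m : ℝ, 0 < m ∧ ∀ yw ∈ N ×ˢ Metric.sphere (0 : E) 1, m ≤ Φ yw := by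
      by_cases hne : (N ×ˢ Metric.sphere (0 : E) 1).Nonempty
      · obtain ⟨yw₀, hyw₀, hmin⟩ := hK.exists_isMinOn hne (hΦc.mono hKsub)
        refine ⟨Φ yw₀, ?_, fun yw hyw ↦ hmin hyw⟩
        have hy₀ : yw₀.1 ∈ e.baseSet := hNe hyw₀.1
        have hw₀ : e.symm yw₀.1 yw₀.2 ≠ 0 := by
          intro h0
          have h2 : e.symmL ℝ yw₀.1 yw₀.2 = 0 := by rwa [e.symmL_apply (R := ℝ) hy₀]
          have h3 := congrArg (e.continuousLinearMapAt ℝ yw₀.1) h2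
          rw [e.continuousLinearMapAt_symmL hy₀, map_zero] at h3
          have h4 : ‖yw₀.2‖ = 1 := by simpa using hyw₀.2
          rw [h3, norm_zero] at h4
          exact zero_ne_one h4
        exact hpos _ _ hw₀
      · exact ⟨1, one_pos, fun yw hyw ↦ (hne ⟨yw, hyw⟩).elim⟩
    obtain ⟨K, hKΨ⟩ : ∃ K : ℝ, ∀ yw ∈ N ×ˢ Metric.sphere (0 : E) 1, |Ψ yw| ≤ K := by
      obtain ⟨K, hK'⟩ := hK.bddAbove_image (continuous_abs.comp_continuousOn (hΨc.mono hKsub))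
      exact ⟨K, fun yw hyw ↦ hK' (mem_image_of_mem _ hyw)⟩
    have hK0 : 0 ≤ K ^ 2 := sq_nonneg K
    refine ⟨N, hN, K ^ 2 / m + 1, by positivity, fun p hp ↦ ?_⟩
    have hpe : p.proj ∈ e.baseSet := hNe hp
    set w : E := (e p).2 with hw_def
    have hsym : e.symm p.proj w = p.2 := e.symm_proj_apply p hpe
    have hnn : 0 ≤ g.val p.proj p.2 p.2 := by
      by_cases h0 : p.2 = 0
      · rw [h0]; simp
      · exact (hpos _ _ h0).le
    by_cases hw0 : w = 0
    · have hp0 : p.2 = 0 := by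
        rw [← hsym, hw0, ← e.symmL_apply (R := ℝ) hpe, map_zero]
      rw [hp0]
      simp
    have hwpos : 0 < ‖w‖ := norm_pos_iff.2 hw0
    set u : E := ‖w‖⁻¹ • w with hu_def
    have hu : u ∈ Metric.sphere (0 : E) 1 := by
      rw [mem_sphere_zero_iff_norm, hu_def, norm_smul, norm_inv, norm_norm,
        inv_mul_cancel₀ hwpos.ne']
    have hwu : w = ‖w‖ • u := by
      rw [hu_def, smul_smul, mul_inv_cancel₀ hwpos.ne', one_smul]
    -- express `p.2` through the unit vector `u`
    have hp2 : p.2 = ‖w‖ • e.symm p.proj u := by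
      rw [← hsym, ← e.symmL_apply (R := ℝ) hpe, ← e.symmL_apply (R := ℝ) hpe, ← map_smul, ← hwu]
    have h1 : m ≤ Φ (p.proj, u) := hmΦ _ ⟨hp, hu⟩
    have h2 : |Ψ (p.proj, u)| ≤ K := hKΨ _ ⟨hp, hu⟩
    have h3 : (Ψ (p.proj, u)) ^ 2 ≤ K ^ 2 := by
      rw [← sq_abs, ← sq_abs K]
      exact pow_le_pow_left₀ (abs_nonneg _) (h2.trans (le_abs_self K)) 2
    have hval : g.val p.proj p.2 p.2 = ‖w‖ ^ 2 * Φ (p.proj, u) := by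
      rw [hp2]
      simp only [hΦ_def, map_smul, FunLike.coe_smul, Pi.smul_apply, smul_eq_mul]
      ring
    have hder : mvfderiv I ρ p.proj p.2 = ‖w‖ * Ψ (p.proj, u) := by
      rw [hp2]
      simp only [hΨ_def, map_smul, smul_eq_mul]
    rw [hval, hder]
    have h4 : (‖w‖ * Ψ (p.proj, u)) ^ 2 ≤ ‖w‖ ^ 2 * K ^ 2 := by
      rw [mul_pow]
      exact mul_le_mul_of_nonneg_left h3 (sq_nonneg _)
    have h5 : ‖w‖ ^ 2 * K ^ 2 ≤ (K ^ 2 / m + 1) * (‖w‖ ^ 2 * Φ (p.proj, u)) := by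
      have h6 : K ^ 2 ≤ (K ^ 2 / m + 1) * Φ (p.proj, u) := by
        have h7 : K ^ 2 = K ^ 2 / m * m := by field_simp
        have h8 : K ^ 2 / m * m ≤ K ^ 2 / m * Φ (p.proj, u) :=
          mul_le_mul_of_nonneg_left h1 (by positivity)
        have h9 : 0 ≤ Φ (p.proj, u) := hm.le.trans h1
        nlinarith
      calc ‖w‖ ^ 2 * K ^ 2 ≤ ‖w‖ ^ 2 * ((K ^ 2 / m + 1) * Φ (p.proj, u)) :=
            mul_le_mul_of_nonneg_left h6 (sq_nonneg _)
        _ = (K ^ 2 / m + 1) * (‖w‖ ^ 2 * Φ (p.proj, u)) := by ring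
    exact h4.trans h5
  -- cover `M` by finitely many such neighbourhoods and take the largest constant
  choose N hN C hC hmem using hloc
  obtain ⟨t, -, ht⟩ := isCompact_univ.elim_nhds_subcover N fun x _ ↦ hN x
  refine ⟨∑ x ∈ t, C x + 1,
    add_pos_of_nonneg_of_pos (Finset.sum_nonneg fun z _ ↦ (hC z).le) one_pos, fun x w ↦ ?_⟩
  obtain ⟨y, hy, hxy⟩ := mem_iUnion₂.1 (ht (mem_univ x))
  have h1 := hmem y ⟨x, w⟩ hxy
  have hnn : 0 ≤ g.val x w w := by
    by_cases h0 : w = 0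
    · rw [h0]; simp
    · exact (hpos _ _ h0).le
  have h2 : C y ≤ ∑ z ∈ t, C z + 1 := by
    have := Finset.single_le_sum (f := C) (fun z _ ↦ (hC z).le) hy
    linarith
  exact h1.trans (mul_le_mul_of_nonneg_right h2 hnn)

end UniformBound

/-! ### Completeness of conformally compact metrics -/

section Completeness

variable {E' : Type*} [NormedAddCommGroup E'] [NormedSpace ℝ E'] {H' : Type*} [TopologicalSpace H']
  {I' : ModelWithCorners ℝ E' H'} {X : Type*} [TopologicalSpace X] [ChartedSpace H' X]
  [IsManifold I' ∞ X] {n' : ℕ∞ω}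

omit [IsManifold I ∞ M] in
/-- The derivative of `x ↦ -log (u x)` for a positive function `u` differentiable at `x`:
`d(-log u)_x(v) = -(u x)⁻¹ du_x(v)`. [folklore] -/
theorem hasMFDerivAt_neg_log_comp {u : M → ℝ} {x : M} (hu : MDifferentiableAt I 𝓘(ℝ, ℝ) u x)
    (hux : 0 < u x) :
    HasMFDerivAt I 𝓘(ℝ, ℝ) (fun y ↦ -Real.log (u y)) x
      ((ContinuousLinearMap.smulRight (1 : ℝ →L[ℝ] ℝ) (-(u x)⁻¹)).comp
        (mfderiv I 𝓘(ℝ, ℝ) u x)) := by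
  have h1 : HasDerivAt (fun r : ℝ ↦ -Real.log r) (-(u x)⁻¹) (u x) :=
    (Real.hasDerivAt_log hux.ne').neg
  have h2 : HasMFDerivAt 𝓘(ℝ, ℝ) 𝓘(ℝ, ℝ) (fun r : ℝ ↦ -Real.log r) (u x)
      (ContinuousLinearMap.smulRight (1 : ℝ →L[ℝ] ℝ) (-(u x)⁻¹)) :=
    hasMFDerivAt_iff_hasFDerivAt.2 h1.hasFDerivAt
  exact h2.comp x hu.hasMFDerivAt

/-- **A conformally compact (e.g. asymptotically hyperbolic) Riemannian metric is geodesically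
complete** (Mazzeo 1988, §1; GGSU 2019, p. 3: "The metric `g` is a complete metric"), analytic
form. Let `g` be a positive definite `C^n` metric (`n ≥ 2`) on a Hausdorff manifold `N` without
boundary, `X` a compact manifold (any model with corners) with a positive definite metric `ḡ`,
`j : N → X` and `ρ : X → ℝ` of class `C¹` with `ρ ∘ j > 0`, `j^* ḡ = (ρ ∘ j)² g`, and
`j⁻¹{ρ ≥ s}` compact for every `s > 0`. Then the Levi-Civita connection of `g` is geodesically
complete: `-log (ρ ∘ j)` is a proper function whose `g`-gradient is bounded (by the bound
`|dρ|_ḡ ≤ C` on the compact `X` and `|v|_g = |dj v|_ḡ / ρ`), so Gordon's criterion applies.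
[cite: GrahamEtAl2020, p. 3] -/
theorem isGeodesicallyComplete_of_conformal_embedding [FiniteDimensional ℝ E] [CompleteSpace E]
    [T2Space M] [I.Boundaryless] [Fact (1 ≤ n)] (g : PseudoRiemannianMetric I n E
      (TangentSpace I : M → Type _)) [g.HasLeviCivita] (hn : 2 ≤ n) (hg : g.IsRiemannian)
    [CompactSpace X] [T2Space X] [FiniteDimensional ℝ E']
    (gb : PseudoRiemannianMetric I' n' E' (TangentSpace I' : X → Type _)) (hgb : gb.IsRiemannian)
    {j : M → X} (hj : ContMDiff I I' 1 j) {ρ : X → ℝ} (hρ : ContMDiff I' 𝓘(ℝ, ℝ) 1 ρ)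
    (hρj : ∀ x, 0 < ρ (j x)) (hcpt : ∀ s : ℝ, 0 < s → IsCompact (j ⁻¹' {y | s ≤ ρ y}))
    (hconf : ∀ (x : M) (v : TangentSpace I x),
      gb.val (j x) (mfderiv I I' j x v) (mfderiv I I' j x v) = ρ (j x) ^ 2 * g.val x v v) :
    IsGeodesicallyComplete g.leviCivita := by
  haveI : LocallyCompactSpace M := Manifold.locallyCompact_of_finiteDimensional (M := M) I
  obtain ⟨C, hC, hdρ⟩ := exists_sq_mfderiv_le_mul_val (I := I') (M := X) hgb hρ
  -- the proper function `F = -log (ρ ∘ j)` and its derivative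
  set u : M → ℝ := fun x ↦ ρ (j x) with hu_def
  have hud : ∀ x, MDifferentiableAt I 𝓘(ℝ, ℝ) u x := fun x ↦
    ((hρ.mdifferentiableAt one_ne_zero).comp x (hj.mdifferentiableAt one_ne_zero))
  have hdu : ∀ (x : M) (v : TangentSpace I x),
      mvfderiv I u x v = mvfderiv I' ρ (j x) (mfderiv I I' j x v) := by
    intro x v
    have h := mfderiv_comp x (hρ.mdifferentiableAt one_ne_zero) (hj.mdifferentiableAt one_ne_zero)
    change (mfderiv I 𝓘(ℝ, ℝ) (ρ ∘ j) x) v = (mfderiv I' 𝓘(ℝ, ℝ) ρ (j x)) (mfderiv I I' j x v)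
    rw [h]
    rfl
  set F : M → ℝ := fun x ↦ -Real.log (u x) with hF_def
  have hFd : ∀ x, HasMFDerivAt I 𝓘(ℝ, ℝ) F x
      ((ContinuousLinearMap.smulRight (1 : ℝ →L[ℝ] ℝ) (-(u x)⁻¹)).comp (mfderiv I 𝓘(ℝ, ℝ) u x)) :=
    fun x ↦ hasMFDerivAt_neg_log_comp (hud x) (hρj x)
  have hFdiff : ∀ x, MDifferentiableAt I 𝓘(ℝ, ℝ) F x := fun x ↦ (hFd x).mdifferentiableAt
  have hdF : ∀ (x : M) (v : TangentSpace I x), mvfderiv I F x v = -(u x)⁻¹ * mvfderiv I u x v := by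
    intro x v
    have h := (hFd x).mfderiv
    have e1 : mvfderiv I F x v = (mfderiv I 𝓘(ℝ, ℝ) F x) v := rfl
    rw [e1, h]
    exact mul_comm (mvfderiv I u x v) (-(u x)⁻¹)
  -- the gradient bound
  have hbound : ∀ (x : M) (v : TangentSpace I x),
      |mvfderiv I F x v| ≤ Real.sqrt C * Real.sqrt (g.val x v v) := by
    intro x v
    have hux : 0 < u x := hρj x
    have h1 := hdρ (j x) (mfderiv I I' j x v)
    rw [hconf x v, ← hdu x v] at h1
    -- `(du v)² ≤ C ρ² g(v,v)`, hence `|du v| ≤ √C ρ √g(v,v)`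
    have hgnn : 0 ≤ g.val x v v := by
      by_cases h0 : v = 0
      · rw [h0]; simp
      · exact (hg x v h0).le
    have h2 : |mvfderiv I u x v| ≤ Real.sqrt C * u x * Real.sqrt (g.val x v v) := by
      have h3 : (mvfderiv I u x v) ^ 2 ≤ (Real.sqrt C * u x * Real.sqrt (g.val x v v)) ^ 2 := by
        have h4 : (Real.sqrt C * u x * Real.sqrt (g.val x v v)) ^ 2 =
            C * (u x ^ 2 * g.val x v v) := by
          rw [mul_pow, mul_pow, Real.sq_sqrt hC.le, Real.sq_sqrt hgnn, mul_assoc]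
        rw [h4]
        simpa only [hu_def] using h1
      exact abs_le_of_sq_le_sq' h3 (by positivity) |>.2 |> fun h ↦
        abs_le.2 ⟨by linarith [(abs_le_of_sq_le_sq' h3 (by positivity)).1], h⟩
    rw [hdF x v, abs_mul, abs_neg, abs_inv, abs_of_pos hux]
    calc (u x)⁻¹ * |mvfderiv I u x v|
        ≤ (u x)⁻¹ * (Real.sqrt C * u x * Real.sqrt (g.val x v v)) :=
          mul_le_mul_of_nonneg_left h2 (inv_nonneg.2 hux.le)
      _ = Real.sqrt C * Real.sqrt (g.val x v v) := by field_simp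
  -- properness of `F`
  have hproper : ∀ s : ℝ, ∃ K : Set M, IsCompact K ∧ ∀ q, F q ≤ s → q ∈ K := by
    intro s
    refine ⟨j ⁻¹' {y | Real.exp (-s) ≤ ρ y}, hcpt _ (Real.exp_pos _), fun q hq ↦ ?_⟩
    show Real.exp (-s) ≤ ρ (j q)
    have hq' : -s ≤ Real.log (u q) := by
      simp only [hF_def] at hq
      linarith
    exact (Real.le_log_iff_exp_le (hρj q)).1 hq'
  exact g.isGeodesicallyComplete_of_properFunction hn hg (Real.sqrt_nonneg C) hFdiff hbound hproper

/-- **A conformally compact Riemannian metric is geodesically complete**, in the setting of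
`Literature.Geometry.Riemannian.ggsu_boundary_sphere_of_nonTrapping_of_nonpos` (GGSU 2019, p. 3):
`j : N → X` a `C¹` topological embedding onto the interior of the compact manifold with boundary
`X`, `ρ ≥ 0` of class `C¹` on `X` vanishing exactly on `∂X`, and `j^* ḡ = (ρ ∘ j)² g`.
[cite: GrahamEtAl2020, p. 3] -/
theorem isGeodesicallyComplete_of_conformallyCompact [FiniteDimensional ℝ E] [CompleteSpace E]
    [T2Space M] [I.Boundaryless] [Fact (1 ≤ n)] (g : PseudoRiemannianMetric I n E
      (TangentSpace I : M → Type _)) [g.HasLeviCivita] (hn : 2 ≤ n) (hg : g.IsRiemannian)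
    [CompactSpace X] [T2Space X] [FiniteDimensional ℝ E']
    (gb : PseudoRiemannianMetric I' n' E' (TangentSpace I' : X → Type _)) (hgb : gb.IsRiemannian)
    {j : M → X} (hj : ContMDiff I I' 1 j) (hje : Topology.IsEmbedding j)
    (hjr : range j = I'.interior X) {ρ : X → ℝ} (hρ : ContMDiff I' 𝓘(ℝ, ℝ) 1 ρ)
    (hρ0 : ∀ y, 0 ≤ ρ y) (hρb : ∀ y, ρ y = 0 ↔ y ∈ I'.boundary X)
    (hconf : ∀ (x : M) (v : TangentSpace I x),
      gb.val (j x) (mfderiv I I' j x v) (mfderiv I I' j x v) = ρ (j x) ^ 2 * g.val x v v) :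
    IsGeodesicallyComplete g.leviCivita := by
  -- `ρ ∘ j > 0`: `j x` is an interior point, hence not a boundary point
  have hρj : ∀ x, 0 < ρ (j x) := by
    intro x
    have hx : j x ∈ I'.interior X := hjr ▸ mem_range_self x
    have hnb : j x ∉ I'.boundary X := fun hb ↦
      Set.disjoint_left.1 (ModelWithCorners.disjoint_interior_boundary (I := I') (M := X)) hx hb
    exact lt_of_le_of_ne (hρ0 _) fun h0 ↦ hnb ((hρb _).1 h0.symm)
  -- `j⁻¹{ρ ≥ s}` is compact for `s > 0`: `{ρ ≥ s}` is a compact subset of the interior `= range j`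
  have hcpt : ∀ s : ℝ, 0 < s → IsCompact (j ⁻¹' {y | s ≤ ρ y}) := by
    intro s hs
    have hclosed : IsClosed {y : X | s ≤ ρ y} := isClosed_le continuous_const hρ.continuous
    refine hje.isInducing.isCompact_preimage' hclosed.isCompact fun y hy ↦ ?_
    rw [hjr, ← ModelWithCorners.compl_boundary]
    intro hb
    have h0 : ρ y = 0 := (hρb y).2 hb
    have : s ≤ ρ y := hy
    linarith
  exact isGeodesicallyComplete_of_conformal_embedding g hn hg gb hgb hj hρ hρj hcpt hconf

end Completeness

end SimpleAH

end Literature.Geometry.Riemannian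

end
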